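import Literature.Analysis.FluidPDE.ForwardDSSAprioriUniversal
import Literature.Analysis.FunctionSpaces.WeakLpSplit
import HarnessLib

/-!
# Forward DSS solutions: Bradshaw–Tsai 2019, Prop. 3.1 from [BT1]'s existence theorem alone

Analysis/FluidPDE proof file (theorems only, no new definitions) proving the named fact
`Literature.Analysis.FluidPDE.bradshawTsai2019_prop_3_1` (Bradshaw–Tsai, Analysis & PDE 12
(2019) = arXiv:1801.08060, Prop. 3.1; `ForwardDSSExistence.lean`) **from** the local pressure
expansion of Kang–Miura–Tsai (**PD**, `kangMiuraTsai_pressure_decomposition`), Stein's `L^p`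
bound for the Riesz-transform pressure (**CZ**, `stein1970_normalisedPressure_ae_Lp_bound`) and
[BT1]'s Theorem 1.2 (`bradshawTsai2017_dss_localLeray_existence`: every divergence free `λ`-DSS
`v₀ ∈ L³_w` is the datum of a `λ`-DSS local Leray solution):

* `bradshawTsai2019_prop_3_1_of_localLeray_existence : PD → CZ → [BT1] Thm 1.2 → Prop. 3.1`.

The printed Prop. 3.1 concerns "the `λ`-DSS local Leray solution constructed in [BT1]" and is
proved on the approximants of that construction; the tree renders it existentially
(`bradshawTsai2019_prop_3_1`: for every `M` there are `T, C` such that every admissible datum with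
`‖v₀‖²_{L²(B_λ)} ≤ M` has *some* `λ`-DSS local Leray solution obeying the three bounds). The
accepted `BradshawTsai2019.exists_apriori_ae` (`ForwardDSSAprioriUniversal.lean`) is the printed
estimate (3.12) with the pressure bound of p. 10 for **every** `λ`-DSS local Leray solution with
gauged pressure, a.e. in time; the printed continuity argument (3.13) ⇒ (3.14) in its a.e. form
(accepted `BradshawTsai2019.continuity_argument_ae`, `ForwardDSSRunningSup.lean`) then yields the
three bounds on `(0, T]`, `T = T(M, λ)`, for the [BT1] solution with its Kang–Miura–Tsai gauged
pressure (accepted `exists_gaugedPressure`; the datum lies in `E²` by `memE2_of_memWeakLp_three`,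
`L^{3,∞} ⊂ L² + L⁴ ⊂ E²`). Hence, combined with the accepted reduction of the root
`bradshawTsai2019_dss_existence_of_prop_3_1` (`ForwardDSSCylinderCompactnessHolds.lean`),
**Theorem 1.2 of Bradshaw–Tsai 2019 rests on {PD, CZ, [BT1] Thm 1.2}** — of which PD and CZ are
theorems of the tree (`kangMiuraTsai_pressure_decomposition_holds`,
`stein1970_normalisedPressure_ae_Lp_bound_holds`); the corollaries with these discharges plugged in
are kept in a sibling file so that this one stays light.

## References

* Z. Bradshaw, T.-P. Tsai, Analysis & PDE 12 (2019) 1943–1962 = arXiv:1801.08060, §3, Prop. 3.1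
  and its proof (pp. 8–10), (3.12)–(3.14) [BradshawTsai2019].
* Z. Bradshaw, T.-P. Tsai, Ann. Henri Poincaré 18 (2017) = arXiv:1510.07504, Thm 1.2
  [BradshawTsai2017AHP].
* K. Kang, H. Miura, T.-P. Tsai, IMRN 2021 = arXiv:1812.10509, Def. 3.2, Lemma 3.4
  [KangMiuraTsai2020].
-/

noncomputable section

open MeasureTheory Set Function Filter Topology TopologicalSpace Metric
open scoped NNReal ENNReal

namespace Literature.Analysis.FluidPDE

namespace BradshawTsai2019

/-! ## Weak-`L³` data lie in `E²` -/

/-- **`L^{3,∞}(ℝ³) ⊂ E²`**: a weak-`L³` field is uniformly locally square integrable with unit-ball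
energies decaying at infinity (split a strongly measurable representative at height `1`: the high
part is in `L²`, the low part in `L⁴` — accepted `MemWeakLp.memLp_indicator_one_lt_norm`,
`memLp_indicator_norm_le_one` —, both lie in `E²` by the accepted `memE2_of_memLp`, and
`∫_B|f|² ≤ 2∫_B|f₁|² + 2∫_B|f₂|²`). [folklore] -/
theorem memE2_of_memWeakLp_three {v₀ : EuclideanSpace ℝ (Fin 3) → EuclideanSpace ℝ (Fin 3)}
    (hw : FunctionSpaces.MemWeakLp v₀ 3 volume) : MemE2 v₀ := by
  -- a strongly measurable representative and its splitting
  set f : EuclideanSpace ℝ (Fin 3) → EuclideanSpace ℝ (Fin 3) := hw.aestronglyMeasurable.mk v₀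
    with hf
  have hfm : StronglyMeasurable f := hw.aestronglyMeasurable.stronglyMeasurable_mk
  have hvf : v₀ =ᵐ[volume] f := hw.aestronglyMeasurable.ae_eq_mk
  have hwf : FunctionSpaces.MemWeakLp f 3 volume := hw.congr_ae hvf
  set f₁ : EuclideanSpace ℝ (Fin 3) → EuclideanSpace ℝ (Fin 3) := {x | 1 < ‖f x‖}.indicator f
    with hf₁
  set f₂ : EuclideanSpace ℝ (Fin 3) → EuclideanSpace ℝ (Fin 3) := {x | ‖f x‖ ≤ 1}.indicator f
    with hf₂
  have h₁ : MemLp f₁ 2 volume :=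
    hwf.memLp_indicator_one_lt_norm hfm (by norm_num) two_ne_zero (by norm_num)
  have h₂ : MemLp f₂ 4 volume :=
    hwf.memLp_indicator_norm_le_one hfm (by norm_num) (by norm_num)
  have hE₁ : MemE2 f₁ := memE2_of_memLp h₁ le_rfl ENNReal.ofNat_ne_top
  have hE₂ : MemE2 f₂ := memE2_of_memLp h₂ (by norm_num) ENNReal.ofNat_ne_top
  have hsplit : ∀ x, f x - f₂ x = f₁ x := fun x => by
    have h := congrFun (FunctionSpaces.indicator_one_lt_norm_add_indicator_norm_le_one f) x
    simp only [Pi.add_apply] at h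
    rw [← h]
    show f₁ x + f₂ x - f₂ x = f₁ x
    exact add_sub_cancel_right _ _
  -- the unit-ball energies of `f`
  have hball : ∀ x₀ : EuclideanSpace ℝ (Fin 3), ∫⁻ x in ball x₀ 1, ‖f x‖ₑ ^ 2 ≤
      2 * (∫⁻ x in ball x₀ 1, ‖f₁ x‖ₑ ^ 2) + 2 * ∫⁻ x in ball x₀ 1, ‖f₂ x‖ₑ ^ 2 := by
    intro x₀
    have h := setLIntegral_enorm_sq_le_two_mul (ball x₀ 1) hfm.aestronglyMeasurable
      h₂.aestronglyMeasurable
    simp only [hsplit] at h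
    exact h
  have hfv : ∀ x₀ : EuclideanSpace ℝ (Fin 3), ∫⁻ x in ball x₀ 1, ‖v₀ x‖ₑ ^ 2 =
      ∫⁻ x in ball x₀ 1, ‖f x‖ₑ ^ 2 := fun x₀ =>
    lintegral_congr_ae ((ae_restrict_of_ae hvf).mono fun x hx => by
      show ‖v₀ x‖ₑ ^ 2 = ‖f x‖ₑ ^ 2
      rw [hx])
  obtain ⟨C₁, hC₁⟩ := hE₁.uniformlyLocal
  obtain ⟨C₂, hC₂⟩ := hE₂.uniformlyLocal
  refine ⟨hw.aestronglyMeasurable, ⟨2 * C₁ + 2 * C₂, fun x₀ => ?_⟩, ?_⟩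
  · rw [hfv]
    calc ∫⁻ x in ball x₀ 1, ‖f x‖ₑ ^ 2
        ≤ 2 * (∫⁻ x in ball x₀ 1, ‖f₁ x‖ₑ ^ 2) + 2 * ∫⁻ x in ball x₀ 1, ‖f₂ x‖ₑ ^ 2 := hball x₀
      _ ≤ 2 * C₁ + 2 * C₂ := add_le_add (mul_le_mul' le_rfl (hC₁ x₀)) (mul_le_mul' le_rfl (hC₂ x₀))
      _ = ((2 * C₁ + 2 * C₂ : ℝ≥0) : ℝ≥0∞) := by push_cast; rfl
  · have hlim : Tendsto (fun x₀ : EuclideanSpace ℝ (Fin 3) =>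
        2 * (∫⁻ x in ball x₀ 1, ‖f₁ x‖ₑ ^ 2) + 2 * ∫⁻ x in ball x₀ 1, ‖f₂ x‖ₑ ^ 2)
        (cocompact (EuclideanSpace ℝ (Fin 3))) (𝓝 0) := by
      have h1 := ENNReal.Tendsto.const_mul hE₁.decay (Or.inr ENNReal.ofNat_ne_top) (a := 2)
      have h2 := ENNReal.Tendsto.const_mul hE₂.decay (Or.inr ENNReal.ofNat_ne_top) (a := 2)
      rw [mul_zero] at h1 h2
      simpa using h1.add h2
    refine tendsto_of_tendsto_of_tendsto_of_le_of_le tendsto_const_nhds hlim (fun _ => bot_le)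
      fun x₀ => ?_
    rw [hfv]
    exact hball x₀

/-! ## Prop. 3.1 for [BT1]'s solution from the universal a priori estimate -/

/-- **Bradshaw–Tsai 2019, Prop. 3.1, from PD, CZ and [BT1] Thm 1.2** (arXiv:1801.08060, Prop. 3.1
with its proof pp. 8–10). Given `λ > 1` and `M`, put `a = M + 1`, choose `0 < T' ≤ 1` with
`K T' (2 + 8a²) < 1` for the constant `K = K(λ)` of `exists_apriori_ae`, and `T = T'/2`. For a
divergence free `λ`-DSS `v₀ ∈ L³_w` with `‖v₀‖²_{L²(B_λ)} ≤ M`, let `(v, π)` be a `λ`-DSS local Leray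
solution with datum `v₀` ([BT1] Thm 1.2) and `ϖ` its gauged pressure on `B_λ`
(`exists_gaugedPressure`; `v₀ ∈ E²`). By (3.12) a.e. (`exists_apriori_ae`) and the continuity
argument (`continuity_argument_ae`; `α` is essentially bounded on `(0,1)` by the uniformly local
energy, the dissipation on `(0,1) × B₁` is finite): `α̃(T') ≤ 2a`, `M + K∫₀^{T'}(α̃³ + α̃) ≤ 2a`
and `α(s) + ∫∫_{(0,s)×B₁}|∇v|² ≤ 2a` for a.e. `s < T'`; hence `∫_{B₁}|v(t)|² ≤ 2a` for a.e. `t < T`,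
`∫∫_{(0,T)×B₁}|∇v|² ≤ 2a` (through a good `s ∈ (T, T')`), and
`∫∫_{(0,T)×B₁}|ϖ|^{3/2} ≤ K(2a) + 2a` by the pressure bound. [cite: BradshawTsai2019, Prop 3.1 (proof pp. 8–10, (3.12)–(3.14))] -/
theorem _root_.Literature.Analysis.FluidPDE.bradshawTsai2019_prop_3_1_of_localLeray_existence
    (hPD : kangMiuraTsai_pressure_decomposition) (hCZ : stein1970_normalisedPressure_ae_Lp_bound)
    (hE : bradshawTsai2017_dss_localLeray_existence) : bradshawTsai2019_prop_3_1 := by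
  intro c hc M
  have hc0 : 0 < c := zero_lt_one.trans hc
  obtain ⟨K, hKtop, hK⟩ := exists_apriori_ae hCZ hc
  -- ### the constants `a`, `T'`, `T`, `C`
  have hMtop : ((M : ℝ≥0) : ℝ≥0∞) ≠ ⊤ := ENNReal.coe_ne_top
  set a : ℝ≥0∞ := (M : ℝ≥0∞) + 1 with ha
  have hatop : a ≠ ⊤ := ENNReal.add_ne_top.2 ⟨hMtop, ENNReal.one_ne_top⟩
  set Q : ℝ≥0∞ := K * (2 + 8 * a ^ 2) with hQ
  have hQtop : Q ≠ ⊤ := ENNReal.mul_ne_top hKtop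
    (ENNReal.add_ne_top.2 ⟨ENNReal.ofNat_ne_top, ENNReal.mul_ne_top ENNReal.ofNat_ne_top
      (ENNReal.pow_ne_top hatop)⟩)
  set q : ℝ := Q.toReal with hq
  have hq0 : 0 ≤ q := ENNReal.toReal_nonneg
  set T' : ℝ := min 1 (1 / (2 * (q + 1))) with hT'
  have hT'0 : 0 < T' := lt_min one_pos (by positivity)
  have hT'1 : T' ≤ 1 := min_le_left _ _
  have hsmall : K * ENNReal.ofReal T' * (2 + 8 * ((M : ℝ≥0∞) + 1) ^ 2) < 1 := by
    have e1 : K * ENNReal.ofReal T' * (2 + 8 * ((M : ℝ≥0∞) + 1) ^ 2) = ENNReal.ofReal T' * Q := by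
      rw [hQ, ha]; ring
    rw [e1, ← ENNReal.ofReal_toReal hQtop, ← hq, ← ENNReal.ofReal_mul hT'0.le,
      ENNReal.ofReal_lt_one]
    have h1 : T' * q ≤ 1 / (2 * (q + 1)) * q :=
      mul_le_mul_of_nonneg_right (min_le_right _ _) hq0
    have h2 : 1 / (2 * (q + 1)) * q < 1 := by
      rw [div_mul_eq_mul_div, one_mul, div_lt_one (by positivity)]
      linarith
    exact lt_of_le_of_lt h1 h2
  set T : ℝ := T' / 2 with hT
  have hT0 : 0 < T := by positivity
  have hTT' : T < T' := by rw [hT]; linarith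
  set Ce : ℝ≥0∞ := 2 * a + (K * (2 * a) + 2 * a) with hCe
  have hCetop : Ce ≠ ⊤ := ENNReal.add_ne_top.2 ⟨ENNReal.mul_ne_top ENNReal.ofNat_ne_top hatop,
    ENNReal.add_ne_top.2 ⟨ENNReal.mul_ne_top hKtop (ENNReal.mul_ne_top ENNReal.ofNat_ne_top hatop),
      ENNReal.mul_ne_top ENNReal.ofNat_ne_top hatop⟩⟩
  have hCe1 : 2 * a ≤ Ce := le_self_add
  have hCe2 : K * (2 * a) + 2 * a ≤ Ce := le_add_self
  refine ⟨T, hT0, Ce.toNNReal, ?_⟩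
  rw [ENNReal.coe_toNNReal hCetop]
  intro v₀ hw hdiv hdss hM
  -- ### the [BT1] solution, its gauged pressure and gradient
  obtain ⟨v, π, hLL, hdssv⟩ := hE hc hw hdiv hdss
  have hE2 : MemE2 v₀ := memE2_of_memWeakLp_three hw
  obtain ⟨ϖ, hvϖ, hdecT⟩ := exists_gaugedPressure hPD hE2 hdiv hLL hc0
  obtain ⟨G, hG, hGb⟩ := hvϖ.uniformLocalGradient
  have hm₀ : AEStronglyMeasurable v₀ volume := hw.aestronglyMeasurable
  -- finiteness of the dissipation on `(0,1) × B₁` and the essential bound of `α` on `(0,1)`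
  have hDfin : (∫⁻ z in Ioo 0 1 ×ˢ ball (0 : EuclideanSpace ℝ (Fin 3)) 1,
      ENNReal.ofReal (frobeniusNormSq (G z.1 z.2))) ≠ ⊤ := by
    obtain ⟨C₀, hC₀⟩ := hGb 1 one_pos
    have h := hC₀ 0
    rw [one_pow] at h
    exact ne_top_of_le_ne_top ENNReal.coe_ne_top h
  obtain ⟨B, hB⟩ := hvϖ.uniformLocalEnergy 1 one_pos
  have hαB : ∀ᵐ σ ∂(volume.restrict (Ioo (0 : ℝ) 1)), ballEnergy v σ ≤ B := by
    rw [one_pow] at hB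
    filter_upwards [hB] with σ hσ
    exact hσ 0
  -- ### (3.12) a.e. and the pressure bound
  obtain ⟨hAE, hPB⟩ := hK hm₀ hvϖ hdssv hG (hdecT 1 one_pos) hDfin
  have hAE' : ∀ᵐ s ∂(volume.restrict (Ioo (0 : ℝ) 1)),
      ballEnergy v s + (∫⁻ z in Ioo 0 s ×ˢ ball (0 : EuclideanSpace ℝ (Fin 3)) 1,
        ENNReal.ofReal (frobeniusNormSq (G z.1 z.2))) ≤
      (M : ℝ≥0∞) + K * ∫⁻ σ in Ioo 0 s, (essSup (ballEnergy v) (volume.restrict (Ioo 0 σ)) ^ 3 +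
        essSup (ballEnergy v) (volume.restrict (Ioo 0 σ))) := by
    filter_upwards [hAE] with s hs
    exact hs.trans (add_le_add hM le_rfl)
  -- ### the continuity argument
  obtain ⟨hET', hFT', hae⟩ := continuity_argument_ae (D := fun s =>
    ∫⁻ z in Ioo 0 s ×ˢ ball (0 : EuclideanSpace ℝ (Fin 3)) 1,
      ENNReal.ofReal (frobeniusNormSq (G z.1 z.2))) hMtop hKtop ENNReal.coe_ne_top hαB hAE'
    hT'0 hT'1 hsmall
  -- a good time `s ∈ (T, T')`
  obtain ⟨s, hsI, hs⟩ : ∃ s, s ∈ Ioo T T' ∧ ballEnergy v s +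
      (∫⁻ z in Ioo 0 s ×ˢ ball (0 : EuclideanSpace ℝ (Fin 3)) 1,
        ENNReal.ofReal (frobeniusNormSq (G z.1 z.2))) ≤ 2 * ((M : ℝ≥0∞) + 1) := by
    have h1 : ∀ᵐ s ∂(volume.restrict (Ioo T T')), s ∈ Ioo T T' ∧ ballEnergy v s +
        (∫⁻ z in Ioo 0 s ×ˢ ball (0 : EuclideanSpace ℝ (Fin 3)) 1,
          ENNReal.ofReal (frobeniusNormSq (G z.1 z.2))) ≤ 2 * ((M : ℝ≥0∞) + 1) :=
      (ae_restrict_mem measurableSet_Ioo).and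
        (ae_restrict_of_ae_restrict_of_subset (Ioo_subset_Ioo_left hT0.le) hae)
    have hvol : volume (Ioo T T') ≠ 0 := by
      rw [Real.volume_Ioo]
      exact (ENNReal.ofReal_pos.2 (by linarith)).ne'
    haveI : NeZero (volume.restrict (Ioo T T')) := ⟨fun h0 => hvol (Measure.restrict_eq_zero.1 h0)⟩
    exact h1.exists
  refine ⟨v, ϖ, hvϖ, hdssv, ?_, ⟨G, hG, ?_⟩, ?_⟩
  · -- the sliced energy on `(0, T)`
    filter_upwards [ae_restrict_of_ae_restrict_of_subset (Ioo_subset_Ioo_right hTT'.le) hae]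
      with t ht
    exact (le_self_add.trans ht).trans hCe1
  · -- the dissipation on `(0, T) × B₁`
    calc (∫⁻ z in Ioo 0 T ×ˢ ball (0 : EuclideanSpace ℝ (Fin 3)) 1,
          ENNReal.ofReal (frobeniusNormSq (G z.1 z.2)))
        ≤ ∫⁻ z in Ioo 0 s ×ˢ ball (0 : EuclideanSpace ℝ (Fin 3)) 1,
            ENNReal.ofReal (frobeniusNormSq (G z.1 z.2)) :=
          lintegral_mono_set (Set.prod_mono (Ioo_subset_Ioo_right hsI.1.le) Subset.rfl)
      _ ≤ 2 * ((M : ℝ≥0∞) + 1) := le_add_self.trans hs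
      _ ≤ Ce := hCe1
  · -- the pressure on `(0, T) × B₁`
    have hTI : T ∈ Ioc (0 : ℝ) 1 := ⟨hT0, (hTT'.le).trans hT'1⟩
    have hint : K * ∫⁻ σ in Ioo 0 T, (essSup (ballEnergy v) (volume.restrict (Ioo 0 σ)) ^ 3 +
        essSup (ballEnergy v) (volume.restrict (Ioo 0 σ))) ≤ 2 * ((M : ℝ≥0∞) + 1) := by
      calc K * ∫⁻ σ in Ioo 0 T, (essSup (ballEnergy v) (volume.restrict (Ioo 0 σ)) ^ 3 +
            essSup (ballEnergy v) (volume.restrict (Ioo 0 σ)))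
          ≤ K * ∫⁻ σ in Ioo 0 T', (essSup (ballEnergy v) (volume.restrict (Ioo 0 σ)) ^ 3 +
              essSup (ballEnergy v) (volume.restrict (Ioo 0 σ))) :=
            mul_le_mul' le_rfl (lintegral_mono_set (Ioo_subset_Ioo_right hTT'.le))
        _ ≤ (M : ℝ≥0∞) + K * ∫⁻ σ in Ioo 0 T', (essSup (ballEnergy v) (volume.restrict (Ioo 0 σ)) ^ 3 +
              essSup (ballEnergy v) (volume.restrict (Ioo 0 σ))) := le_add_self
        _ ≤ 2 * ((M : ℝ≥0∞) + 1) := hFT'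
    have hD : (∫⁻ z in Ioo 0 T ×ˢ ball (0 : EuclideanSpace ℝ (Fin 3)) 1,
        ENNReal.ofReal (frobeniusNormSq (G z.1 z.2))) ≤ 2 * ((M : ℝ≥0∞) + 1) :=
      (lintegral_mono_set (Set.prod_mono (Ioo_subset_Ioo_right hsI.1.le) Subset.rfl)).trans
        (le_add_self.trans hs)
    calc ∫⁻ z in Ioo 0 T ×ˢ ball (0 : EuclideanSpace ℝ (Fin 3)) 1, ‖ϖ z.1 z.2‖ₑ ^ (3 / 2 : ℝ)
        ≤ ∫⁻ z in Ioo 0 T ×ˢ ball (0 : EuclideanSpace ℝ (Fin 3)) c, ‖ϖ z.1 z.2‖ₑ ^ (3 / 2 : ℝ) :=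
          lintegral_mono_set (Set.prod_mono Subset.rfl (ball_subset_ball hc.le))
      _ ≤ K * ((∫⁻ z in Ioo 0 T ×ˢ ball (0 : EuclideanSpace ℝ (Fin 3)) 1,
            ENNReal.ofReal (frobeniusNormSq (G z.1 z.2))) +
            ∫⁻ σ in Ioo 0 T, (essSup (ballEnergy v) (volume.restrict (Ioo 0 σ)) ^ 3 +
              essSup (ballEnergy v) (volume.restrict (Ioo 0 σ)))) := hPB T hTI
      _ = K * (∫⁻ z in Ioo 0 T ×ˢ ball (0 : EuclideanSpace ℝ (Fin 3)) 1,
            ENNReal.ofReal (frobeniusNormSq (G z.1 z.2))) +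
            K * ∫⁻ σ in Ioo 0 T, (essSup (ballEnergy v) (volume.restrict (Ioo 0 σ)) ^ 3 +
              essSup (ballEnergy v) (volume.restrict (Ioo 0 σ))) := mul_add _ _ _
      _ ≤ K * (2 * ((M : ℝ≥0∞) + 1)) + 2 * ((M : ℝ≥0∞) + 1) :=
          add_le_add (mul_le_mul' le_rfl hD) hint
      _ ≤ Ce := hCe2

end BradshawTsai2019

end Literature.Analysis.FluidPDE

end
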